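import Summits.QuantumFields.YangMills.Theorems.BalabanUVNodesN06CurrentMajAtPinsIdPhys

/-!
# BalabanUVNodes ∕ N06 ([B9], `Dag.B9_main`) — THE CURRENT LETTERS `hBJ` OF THE STAGE-11 CERTIFICATE AT A GENERIC CLASS CONSTANT `c`
# (the c-generic twin of dag-n06-w8's `N06CurrentMajAtPinsIdPhys.hBJ_of_pins`; input of the c-generic ∕ P edition of the certificate)

Track A of `YM-PLAN.md` (cell `pub-ymgap`, HUMAN RULING D-0062), node **N06** = [Balaban1985BackgroundPropagators] Thms 3.1–3.15; seat `pub-ymgap-dag-n06-d`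
(gen 14), the knit at the ₁₁ record.  WHY.  Edition 43 of the certificate (`…AtOpsYNuOfRecordV6EPairNX`) derives the binder `hBJ` (the block majorants of the
current operators `B(U) = (i∕2)[J, M(·)]`, `B(U)*` of (3.118)–(3.121)) by dag-n06-w8's `hBJ_of_pins` from the displayed regularity (3.36) of `U` at every fine bond
`hreg`, with the premises of `hreg` and of the conclusion typed LITERALLY at MODULE 3's small-cube class at the record's constant `c35Y`:
`(bg9Y …).Reg335 c35Y α₀ U → (bg9Y …).Reg336 c35Y α₀ U → …`.  The P-EDITION of the certificate (this seat, edition 44: the [B9] leaf over PRINT'S class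
`B9LeafX (Node00.Y9OfRecordP …)` through node00-def-Y's `B9LeafXClassAntitone`) runs the whole certificate body at a GENERIC class constant `c` (then `c ≥ c35B ℓ
= 10·L⁴`, dag-n06-j's bridge), so it needs `hBJ` with `c35Y ↦ c`.  The constant enters dag-n06-w8's chain ONLY as the threshold letter of the two class premises
(the regularity scale is the separate letter `cJ·M·α₀`), so the c-generic twin is the same three-line composition: dag-n06-w8's per-member engine
`N06CurrentMajAtPinsPhys.currentMaj_at_pins` (class-free), the (3.117) clauses from node00-def-Y's identity `Node00.OpsYEq3117Identity.hessGradY_eq_comm_JY` by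
`B9Eq3117NormClausesFromIdentity.hg_of_identity_I ∕ hdh_of_identity_I` (unitarity of `U` from the (3.35) premise at ANY constant, `unitary_of_reg335`).
WHAT.  ★★ `hBJ_of_pinsC` — `hBJ_of_pins` VERBATIM with `c35Y ↦ c` (`c : ℝ` free; no sign needed).  At `c := c35Y` it is dag-n06-w8's theorem.
HONEST FRAMING.  Mechanical re-typing of a landed composition (kernel bookkeeping); nothing of [B9]'s analysis asserted beyond the finite-lattice identity (3.117)
(node00-def-Y's theorem) and [4] (2.51)'s bookkeeping (dag-n06-w8); the regularity (3.36) at every fine bond REMAINS the displayed input `hreg`; COUNT-NEUTRAL;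
N06 NOT discharged; K1⁹ NOT closed; one finite 𝕋⁴ programme at fixed `ε` — NOT continuum ∕ OS ∕ mass gap ∕ Clay.  0 `def`, 0 `sorry`.
-/

noncomputable section

namespace Summit.QuantumFields.YangMills.BalabanUVNodes.N06CurrentMajAtPinsC

open Literature.MathematicalPhysics.QuantumFieldTheory.Balaban1983to89
open Literature.MathematicalPhysics.QuantumFieldTheory.Balaban1983to89.Node00 (CfgY SiteY FBondY IBondY JY Stage3Params etaBY)
open Literature.MathematicalPhysics.QuantumFieldTheory.Balaban1983to89.B9PerturbationMajorantAlgebra (CurrentMaj)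
open Literature.MathematicalPhysics.QuantumFieldTheory.Balaban1983to89.B9PerturbationMajorantsAtLetters (BcoKH BdcoKH)
open Literature.MathematicalPhysics.QuantumFieldTheory.Balaban1983to89.B9PinMembersKLevelV1 (MemberY geo9Y bg9Y)
open Literature.MathematicalPhysics.QuantumFieldTheory.Balaban1983to89.B7Prop2SpecialUnitary (specialUnitaryUnits)
open Literature.MathematicalPhysics.QuantumFieldTheory.Balaban1983to89.B9CoReadingCoords (XBK blkBK)
open Literature.MathematicalPhysics.QuantumFieldTheory.Balaban1983to89.B9CoReadingCoordsH (XHK)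
open Literature.MathematicalPhysics.QuantumFieldTheory.Balaban1983to89.B9CoReadingCoordsS (XSK blkSK sIK)
open Literature.MathematicalPhysics.QuantumFieldTheory.Balaban1983to89.B9CoReadingCoordsTranspose (TrIdx trBasis)
open Literature.MathematicalPhysics.QuantumFieldTheory.Balaban1983to89.B9Eq336CurrentBound (RegularAt)
open Literature.MathematicalPhysics.QuantumFieldTheory.Balaban1983to89.B9BackgroundsKLevelV1 (shiftsV1)
open Literature.MathematicalPhysics.QuantumFieldTheory.Balaban1983to89.B6GlobalChartV1 (PV blkV1 boxEquiv)
open Literature.MathematicalPhysics.QuantumFieldTheory.Balaban1983to89.B6Ineq2142KLevelV1 (β)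
open Literature.MathematicalPhysics.QuantumFieldTheory.Balaban1983to89.B6Geom246MultiLevelTorus (geomT)
open Literature.MathematicalPhysics.QuantumFieldTheory.Balaban1983to89.B9Eq3117NormClausesFromIdentity (hg_of_identity_I hdh_of_identity_I unitary_of_reg335)
open Summit.QuantumFields.YangMills.BalabanUVNodes.N06CurrentMajAtPinsPhys (currentMaj_at_pins)
open Summit.QuantumFields.YangMills.BalabanUVNodes.N06CurrentMajAtPinsIdPhys (cf_pos)
open Literature.MathematicalPhysics.QuantumFieldTheory.Balaban1983to89.Node00.OpsYEq3117Identity (hessGradY_eq_comm_JY)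
open scoped Matrix.Norms.L2Operator

variable {N : ℕ} [NeZero N] {θ : Stage3Params} {Mstar : ℕ}
variable [∀ x : MemberY θ.d₆ θ.ℓ₆ θ.hd' θ.hL' θ.b₀ θ.b₁ Mstar, Fintype (geo9Y x).Site]

/-- ★★ **THE CERTIFICATE's BINDER `hBJ` AT A GENERIC CLASS CONSTANT `c`** (dag-n06-w8's `hBJ_of_pins` with `c35Y ↦ c`): from the displayed regularity at every
fine bond `hreg` (premises `(bg9Y …).Reg335 c α₀ U → (bg9Y …).Reg336 c α₀ U`), the pins `hbI0 hβ1 hblk12 hblkW12` and the numerics `0 ≤ cJ`, `cJ·a ≤ 1`, `0 ≤ δB`,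
`tJ ≥ 2(d+1)(ℓ+1)³·N·(10⁴(d+1)cJ)·e^{3δB}`; (3.117) is node00-def-Y's theorem `hessGradY_eq_comm_JY`, the clause bookkeeping dag-n06-w8's.
[cite: Balaban1985BackgroundPropagators, (3.117) p.419, (3.36) p.396, p.422; Balaban1984PropagatorsII, (2.51) p.232] -/
theorem hBJ_of_pinsC (c : ℝ) (H : MemberY θ.d₆ θ.ℓ₆ θ.hd' θ.hL' θ.b₀ θ.b₁ Mstar → Prop)
    (𝔬12 : ∀ x : MemberY θ.d₆ θ.ℓ₆ θ.hd' θ.hL' θ.b₀ θ.b₁ Mstar, B9Thm312Whole.Ops (geo9Y x) (bg9Y (Matrix (Fin N) (Fin N) ℂ) (specialUnitaryUnits (Fin N)) x)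
      (XBK (TrIdx N) x.toKIdx) (XBK (TrIdx N) x.toKIdx) (XHK (TrIdx N) x.toKIdx) (XSK (TrIdx N) x.toKIdx))
    (bI : ∀ x : MemberY θ.d₆ θ.ℓ₆ θ.hd' θ.hL' θ.b₀ θ.b₁ Mstar, FBondY x.toKIdx → IBondY x.toKIdx)
    (hbI0 : ∀ (x : MemberY θ.d₆ θ.ℓ₆ θ.hd' θ.hL' θ.b₀ θ.b₁ Mstar) (f : FBondY x.toKIdx), bI x f = bI x ⟨f.src, 0⟩)
    (hβ1 : ∀ (x : MemberY θ.d₆ θ.ℓ₆ θ.hd' θ.hL' θ.b₀ θ.b₁ Mstar) (f : FBondY x.toKIdx), (geomT x.D).dist (β x.hN x.D x.hk (bI x f)) (blkV1 x.hN x.D f) ≤ 1)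
    (hblk12 : ∀ x : MemberY θ.d₆ θ.ℓ₆ θ.hd' θ.hL' θ.b₀ θ.b₁ Mstar, (𝔬12 x).blk = blkBK x.toKIdx (bI x))
    (hblkW12 : ∀ x : MemberY θ.d₆ θ.ℓ₆ θ.hd' θ.hL' θ.b₀ θ.b₁ Mstar, (𝔬12 x).blkW = blkSK x.toKIdx (sIK x.toKIdx (bI x)))
    (cJ tJ δB M a : ℝ) (hcJ : 0 ≤ cJ) (ha1 : cJ * a ≤ 1) (hδB : 0 ≤ δB)
    (htJ : 2 * ((θ.d₆ : ℝ) + 1) * (((θ.ℓ₆ + 1 : ℕ) : ℝ)) ^ 3 * (N : ℝ) * (10 ^ 4 * ((θ.d₆ : ℝ) + 1) * cJ) * Real.exp (3 * δB) ≤ tJ)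
    (hreg : ∀ x : MemberY θ.d₆ θ.ℓ₆ θ.hd' θ.hL' θ.b₀ θ.b₁ Mstar, M ≤ (geo9Y x).M → ∀ α₀ : ℝ, 0 < α₀ → (geo9Y x).M * α₀ ≤ a →
      ∀ U : (bg9Y (Matrix (Fin N) (Fin N) ℂ) (specialUnitaryUnits (Fin N)) x).Cfg,
        (bg9Y (Matrix (Fin N) (Fin N) ℂ) (specialUnitaryUnits (Fin N)) x).Reg335 c α₀ U →
        (bg9Y (Matrix (Fin N) (Fin N) ℂ) (specialUnitaryUnits (Fin N)) x).Reg336 c α₀ U →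
          ∀ μ s, RegularAt (shiftsV1 (PV θ.d₆ θ.ℓ₆ x.toKIdx.m x.toKIdx.K θ.hd' θ.hL')) U (etaBY x.toKIdx)
            (cJ * ((geo9Y x).M * α₀)) ((geo9Y x).len (bI x ⟨s, 0⟩)) μ s) :
    ∀ x : MemberY θ.d₆ θ.ℓ₆ θ.hd' θ.hL' θ.b₀ θ.b₁ Mstar, M ≤ (geo9Y x).M → ∀ α₀ : ℝ, 0 < α₀ → (geo9Y x).M * α₀ ≤ a →
      ∀ U : (bg9Y (Matrix (Fin N) (Fin N) ℂ) (specialUnitaryUnits (Fin N)) x).Cfg,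
        (bg9Y (Matrix (Fin N) (Fin N) ℂ) (specialUnitaryUnits (Fin N)) x).Reg335 c α₀ U →
        (bg9Y (Matrix (Fin N) (Fin N) ℂ) (specialUnitaryUnits (Fin N)) x).Reg336 c α₀ U →
          CurrentMaj (𝔬12 x).blkW (𝔬12 x).blk
            (BcoKH x.toKIdx (trBasis N) (bg9Y (Matrix (Fin N) (Fin N) ℂ) (specialUnitaryUnits (Fin N)) x) (fun U => U) U)
            (BdcoKH x.toKIdx (trBasis N) (bg9Y (Matrix (Fin N) (Fin N) ℂ) (specialUnitaryUnits (Fin N)) x) (fun U => U) U) 1 (H x)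
            (tJ * ((geo9Y x).M * α₀)) δB := by
  intro x hM α₀ hα ha U hU hU'
  have hN1 : (1 : ℝ) ≤ (N : ℝ) := by exact_mod_cast Nat.one_le_iff_ne_zero.mpr (NeZero.ne N)
  have hC1 : cJ * ((geo9Y x).M * α₀) ≤ 1 := (mul_le_mul_of_nonneg_left ha hcJ).trans ha1
  refine currentMaj_at_pins H x (𝔬12 x) (bI x) (hbI0 x) (hβ1 x) (hblk12 x) (hblkW12 x) (Nat.cast_nonneg N) hcJ hα hC1 hδB htJ U ?_ ?_
    (hreg x hM α₀ hα ha U hU hU')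
  · intro Λ f
    have h := hg_of_identity_I x.toKIdx (fun μ s => (unitary_of_reg335 x hU μ s).2) (fun Λ f => hessGradY_eq_comm_JY x.toKIdx (cf_pos x) U Λ f) Λ f
    exact h.trans (mul_le_mul_of_nonneg_right (mul_le_mul_of_nonneg_right hN1 (norm_nonneg _)) (by positivity))
  · intro A s
    have h := hdh_of_identity_I x.toKIdx U (fun μ z => (unitary_of_reg335 x hU μ z).1) (fun μ z => (unitary_of_reg335 x hU μ z).2)
      (fun Λ f => hessGradY_eq_comm_JY x.toKIdx (cf_pos x) U Λ f) A s
    simpa only [mul_one] using h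

end Summit.QuantumFields.YangMills.BalabanUVNodes.N06CurrentMajAtPinsC

end
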